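import Summits.Ventures.PercRepro.MSTightProj

/-!
# The key lemma on tight families: a set whose differences with a tight family are all
differences of the family lies below a member

`subset_of_diffs_mem` (Lemma 3 of proofs/P4-gen8.md §5): if `K ≠ ∅` is tight and `P` is a set
with `P \ E ∈ K \\ K` for every `E ∈ K`, then `P ⊆ E` for some `E ∈ K`. Induction on a support
finset `u`: if every member of `K` lies inside `P`, Marica–Schönheim on the `|K| + 1` sets
`insert P K` (whose differences are still those of `K`) contradicts tightness; otherwise some
member has an element `r ∉ P`, and projecting along `r` keeps everything (tightness by
`tight_proj_and_partner`) on a smaller support.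
-/

namespace PercRepro.MSTight

open Finset
open scoped FinsetFamily

variable {α : Type*} [DecidableEq α]

/-- `(A.erase r) \ (B.erase r) = (A \ B).erase r`. -/
theorem erase_sdiff_erase (r : α) (A B : Finset α) : A.erase r \ B.erase r = (A \ B).erase r := by
  ext x
  simp only [Finset.mem_sdiff, Finset.mem_erase]
  constructor
  · rintro ⟨⟨hxr, hxA⟩, hxB⟩
    exact ⟨hxr, hxA, fun h => hxB ⟨hxr, h⟩⟩
  · rintro ⟨hxr, hxA, hxB⟩
    exact ⟨⟨hxr, hxA⟩, fun h => hxB h.2⟩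

/-- If `r ∉ P` then `P \ E.erase r = P \ E`. -/
theorem sdiff_erase_of_notMem {r : α} {P : Finset α} (hr : r ∉ P) (E : Finset α) :
    P \ E.erase r = P \ E := by
  ext x
  simp only [Finset.mem_sdiff, Finset.mem_erase]
  constructor
  · rintro ⟨hxP, hxE⟩
    have hxr : x ≠ r := by rintro rfl; exact hr hxP
    exact ⟨hxP, fun h => hxE ⟨hxr, h⟩⟩
  · rintro ⟨hxP, hxE⟩
    exact ⟨hxP, fun h => hxE h.2⟩

/-- **Lemma 3.** A set all of whose differences with a nonempty tight family `K` are differences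
of `K` lies below some member of `K`. -/
theorem subset_of_diffs_mem (u : Finset α) :
    ∀ (K : Finset (Finset α)) (P : Finset α), (∀ E ∈ K, E ⊆ u) → P ⊆ u → K.Nonempty →
      Tight K → (∀ E ∈ K, P \ E ∈ K \\ K) → ∃ E ∈ K, P ⊆ E := by
  induction u using Finset.strongInduction with
  | H u ih =>
    intro K P hKu hPu hne hK hdiff
    by_cases hPK : P ∈ K
    · exact ⟨P, hPK, subset_rfl⟩
    by_cases hall : ∀ E ∈ K, E ⊆ P
    · -- Case 1: every member lies inside `P`; Marica–Schönheim on `insert P K` contradicts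
      -- tightness
      exfalso
      obtain ⟨E₀, hE₀⟩ := hne
      have hsub : insert P K \\ insert P K ⊆ K \\ K := by
        rw [Finset.diffs_subset_iff]
        intro a ha b hb
        rw [Finset.mem_insert] at ha hb
        rcases ha with rfl | ha <;> rcases hb with rfl | hb
        · rw [Finset.sdiff_self]
          exact Finset.mem_diffs.2 ⟨E₀, hE₀, E₀, hE₀, Finset.sdiff_self E₀⟩
        · exact hdiff b hb
        · rw [Finset.sdiff_eq_empty_iff_subset.2 (hall a ha)]
          exact Finset.mem_diffs.2 ⟨E₀, hE₀, E₀, hE₀, Finset.sdiff_self E₀⟩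
        · exact Finset.mem_diffs.2 ⟨a, ha, b, hb, rfl⟩
      have h1 : (insert P K).card ≤ (insert P K \\ insert P K).card :=
        Finset.card_le_card_diffs _
      have h2 : (insert P K \\ insert P K).card ≤ (K \\ K).card := Finset.card_le_card hsub
      have h3 : (insert P K).card = K.card + 1 := Finset.card_insert_of_notMem hPK
      unfold Tight at hK
      omega
    · -- Case 2: some member has an element `r ∉ P`; project along `r`
      push Not at hall
      obtain ⟨E, hE, hEP⟩ := hall
      obtain ⟨r, hrE, hrP⟩ := Finset.not_subset.1 hEP
      have hru : r ∈ u := hKu E hE hrE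
      have hlt : u.erase r ⊂ u := Finset.erase_ssubset hru
      have hK' : Tight (proj r K) := (tight_proj_and_partner hK).1
      have hne' : (proj r K).Nonempty := ⟨E.erase r, mem_proj.2 ⟨E, hE, rfl⟩⟩
      have hKu' : ∀ E' ∈ proj r K, E' ⊆ u.erase r := by
        intro E' hE'
        obtain ⟨B, hB, rfl⟩ := mem_proj.1 hE'
        exact Finset.erase_subset_erase r (hKu B hB)
      have hPu' : P ⊆ u.erase r := Finset.subset_erase.2 ⟨hPu, hrP⟩
      have hdiff' : ∀ E' ∈ proj r K, P \ E' ∈ proj r K \\ proj r K := by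
        intro E' hE'
        obtain ⟨B, hB, rfl⟩ := mem_proj.1 hE'
        rw [sdiff_erase_of_notMem hrP]
        obtain ⟨A, hA, C, hC, hAC⟩ := Finset.mem_diffs.1 (hdiff B hB)
        refine Finset.mem_diffs.2 ⟨A.erase r, mem_proj.2 ⟨A, hA, rfl⟩, C.erase r,
          mem_proj.2 ⟨C, hC, rfl⟩, ?_⟩
        rw [erase_sdiff_erase, hAC]
        exact Finset.erase_eq_of_notMem (fun h => hrP (Finset.mem_sdiff.1 h).1)
      obtain ⟨E', hE', hPE'⟩ := ih (u.erase r) hlt (proj r K) P hKu' hPu' hne' hK' hdiff'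
      obtain ⟨B, hB, rfl⟩ := mem_proj.1 hE'
      exact ⟨B, hB, hPE'.trans (Finset.erase_subset r B)⟩

/-- If `r ∈ T` then `E.erase r ⊆ T ↔ E ⊆ T`. -/
theorem erase_subset_iff_of_mem {r : α} {T : Finset α} (hr : r ∈ T) (E : Finset α) :
    E.erase r ⊆ T ↔ E ⊆ T := by
  constructor
  · intro h x hx
    by_cases hxr : x = r
    · rw [hxr]; exact hr
    · exact h (Finset.mem_erase.2 ⟨hxr, hx⟩)
  · intro h
    exact (Finset.erase_subset r E).trans h

/-- **Lemma 3, dual form.** A set `T` such that `E \ T` is a difference of the nonempty tight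
family `K` for every `E ∈ K` lies above some member of `K`. -/
theorem exists_subset_of_sdiff_mem (u : Finset α) :
    ∀ (K : Finset (Finset α)) (T : Finset α), (∀ E ∈ K, E ⊆ u) → T ⊆ u → K.Nonempty →
      Tight K → (∀ E ∈ K, E \ T ∈ K \\ K) → ∃ E ∈ K, E ⊆ T := by
  induction u using Finset.strongInduction with
  | H u ih =>
    intro K T hKu hTu hne hK hdiff
    by_cases hTK : T ∈ K
    · exact ⟨T, hTK, subset_rfl⟩
    by_cases hall : ∀ E ∈ K, T ⊆ E
    · -- Case 1: `T` lies inside every member; Marica–Schönheim on `insert T K` contradicts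
      -- tightness
      exfalso
      obtain ⟨E₀, hE₀⟩ := hne
      have hsub : insert T K \\ insert T K ⊆ K \\ K := by
        rw [Finset.diffs_subset_iff]
        intro a ha b hb
        rw [Finset.mem_insert] at ha hb
        rcases ha with rfl | ha <;> rcases hb with rfl | hb
        · rw [Finset.sdiff_self]
          exact Finset.mem_diffs.2 ⟨E₀, hE₀, E₀, hE₀, Finset.sdiff_self E₀⟩
        · rw [Finset.sdiff_eq_empty_iff_subset.2 (hall b hb)]
          exact Finset.mem_diffs.2 ⟨E₀, hE₀, E₀, hE₀, Finset.sdiff_self E₀⟩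
        · exact hdiff a ha
        · exact Finset.mem_diffs.2 ⟨a, ha, b, hb, rfl⟩
      have h1 : (insert T K).card ≤ (insert T K \\ insert T K).card :=
        Finset.card_le_card_diffs _
      have h2 : (insert T K \\ insert T K).card ≤ (K \\ K).card := Finset.card_le_card hsub
      have h3 : (insert T K).card = K.card + 1 := Finset.card_insert_of_notMem hTK
      unfold Tight at hK
      omega
    · -- Case 2: some `r ∈ T` misses a member; project along `r`
      push Not at hall
      obtain ⟨E, hE, hTE⟩ := hall
      obtain ⟨r, hrT, hrE⟩ := Finset.not_subset.1 hTE
      have hru : r ∈ u := hTu hrT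
      have hlt : u.erase r ⊂ u := Finset.erase_ssubset hru
      have hK' : Tight (proj r K) := (tight_proj_and_partner hK).1
      have hne' : (proj r K).Nonempty := ⟨E.erase r, mem_proj.2 ⟨E, hE, rfl⟩⟩
      have hKu' : ∀ E' ∈ proj r K, E' ⊆ u.erase r := by
        intro E' hE'
        obtain ⟨B, hB, rfl⟩ := mem_proj.1 hE'
        exact Finset.erase_subset_erase r (hKu B hB)
      have hTu' : T.erase r ⊆ u.erase r := Finset.erase_subset_erase r hTu
      have hdiff' : ∀ E' ∈ proj r K, E' \ T.erase r ∈ proj r K \\ proj r K := by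
        intro E' hE'
        obtain ⟨B, hB, rfl⟩ := mem_proj.1 hE'
        rw [erase_sdiff_erase]
        obtain ⟨A, hA, C, hC, hAC⟩ := Finset.mem_diffs.1 (hdiff B hB)
        refine Finset.mem_diffs.2 ⟨A.erase r, mem_proj.2 ⟨A, hA, rfl⟩, C.erase r,
          mem_proj.2 ⟨C, hC, rfl⟩, ?_⟩
        rw [erase_sdiff_erase, hAC]
      obtain ⟨E', hE', hE'T⟩ := ih (u.erase r) hlt (proj r K) (T.erase r) hKu' hTu' hne' hK' hdiff'
      obtain ⟨B, hB, rfl⟩ := mem_proj.1 hE'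
      refine ⟨B, hB, (erase_subset_iff_of_mem hrT B).1 (hE'T.trans (Finset.erase_subset r T))⟩

end PercRepro.MSTight
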